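import Summits.QuantumFields.YangMills.Theorems.BalabanUVNodesN15TwoGridStability
import HarnessLib

/-!
# Route «BalabanUVNodes», node N15 = NE2, -a lane, part 42: DOOR (iv) — THE (1.110) ENTRIES «GJ», «∇GJ», «G∇*J», «ΔGJ» AS BLOCK MAJORANTS, GENERIC IN THE
# FINENESS `n`, AND THE η-PAIR OF RECORD (`n = L^k`, `n′ = L^m·L^k`) WITH ONE SET OF CONSTANTS

Cell `pub-ymgap`, seat `pub-ymgap-dag-n15-a` (KNIT-BY-NAME, g11); `--supports stmt-QuantumFields-19910 --as helper`; `HOME/pub-ymgap-dag-n15-a/DOOR-IV-PLAN.md` §7.2∕§7.4(c)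
(route R).  Over part 39 (`…N15TwoGridStability`: `gOp`, `paramsOf`∕`topIdxOf`, the dictionaries `DeltaA_inv_mulVec_ofReal`, `fdiff_mulVec_ofReal`, `star_fdiff_mulVec_ofReal`,
`mem_cubeT_blockOf`, `distSite_eq_tdistT`).
WHY.  Part 39 read the (1.110) entries off `prop12_famG_printed` only at the family's own fineness `n = L^K` (type `Tor (fine (L^K) M)`).  The two-grid defect
`𝔇(G′, G) = −G′(Δ′_aP̂₂ − PΔ_a)G` needs them for the FINE member `G′` typed on `Tor (fine (L^m * L^k) M)` — the type on which King's prolongation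
`pull (kingPrV L k m M)` and parts 34∕35∕37 live — and `fine (L^m * L^k) M` is not definitionally `fine (L^(m+k)) M`.  THIS FILE therefore (§27) restates the entries
for an ARBITRARY setting `latticeSettingP12R n M a K` satisfying `B5.Ineq110_114` (hypothesis `H`, constants explicit; carriers `BlockNorm.ofBlocks (unitTorusGeo L k M)
(fun i ↦ blockOf n M i.1)` with the geometry scale `k` and the fineness `n` independent), adds the fourth entry «ΔGJ» (`Δ = ρ(sLap n)`, §26 dictionary
`Lap_mulVec_ofReal` via the symbol identity `(n(s⁻¹−1))(n(s−1)) = sLapDir`), and (§28) transports `prop12_famG_printed` to the η-pair of record: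
★ `ineq110_114_pair`: ONE `(δ₀, C, C_α, C_ε, C_{αε})` for BOTH `latticeSettingP12R (L^k) M a k` and `latticeSettingP12R (L^m * L^k) M a (m+k)` (all `m_T, k ≥ 1, m`),
through `ineq110_114_congr` (`L^{m+k} = L^m·L^k`; `NeZero` is a `Prop`, so the transport is `Iff.rfl` after `subst`).
CONTENTS.  §25 sources localised in a King block (`suppInL_vec/ten_of_isLoc`, `supNormL_vec/ten_le_loc`, `mem_cubeB_of_blockOf`); §26 `inv_mulVec_ofReal_eq`,
`sTinv_sub_one_mul_sD`, ★ `Lap_mulVec_ofReal`; §27 ★ `hasMaj_gOp_of_ineq`, `hasMaj_grad_of_ineq`, `hasMaj_gDivAdj_of_ineq`, `hasMaj_lap_of_ineq` (all four with majorant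
`C·e^{−δ₀ tdistT}`); §28 `ineq110_114_congr`, ★ `ineq110_114_pair`.
HONEST FRAMING ∕ LIMITS.  Dictionary + bookkeeping; the inequalities are the tree's theorem `prop12_famG_printed` (its Combes–Thomas route, its disclosed divergences); unit
blocks instead of doubled cubes on both sides; tori of record `M_μ = 2L^{m_T}` in §28; `U ≡ 1`; no η-rate here (that is R3 assembly, next); count-neutral (typed 28∕28 ·
discharged 5∕28 unchanged); NOT a discharge of N15 (object-bound; NE2⁺ NOT PRINTED); one finite T⁴ at fixed ε — NOT infinite volume, NOT OS on ℝ⁴, NOT a mass gap, NOT Clay.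
-/

noncomputable section

open scoped BigOperators Matrix
open Finset

namespace Summit.QuantumFields.YangMills.BalabanUVNodes.N15.TwoGrid

open Literature.MathematicalPhysics.QuantumFieldTheory.Balaban1983to89
open Literature.MathematicalPhysics.QuantumFieldTheory.Balaban1983to89.B11SectG (BlockNorm HasMaj)
open Literature.MathematicalPhysics.QuantumFieldTheory.Balaban1983to89.B11AxialTransport190 (abs_le_loc_ofBlocks loc_ofBlocks_le)
open Literature.MathematicalPhysics.QuantumFieldTheory.Balaban1983to89.B5Prop11Plancherel (Tor fine unitVec fdiff)
open Literature.MathematicalPhysics.QuantumFieldTheory.Balaban1983to89.B5DeltaA169 (DeltaA)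
open Literature.MathematicalPhysics.QuantumFieldTheory.Balaban1983to89.B5Prop11Lower (Lap)
open Literature.MathematicalPhysics.QuantumFieldTheory.Balaban1983to89.B5Prop12FieldsLattice (cubeT cubeB distSite suppInL supNormL eL supNormL_nonneg)
open Literature.MathematicalPhysics.QuantumFieldTheory.Balaban1983to89.B5Prop11Lattice (grad divT)
open Literature.MathematicalPhysics.QuantumFieldTheory.Balaban1983to89.B5SettingP12Real (LocR latticeSettingP12R)
open Literature.MathematicalPhysics.QuantumFieldTheory.Balaban1983to89.B5SiteBridgeP12 (nP MP)
open Literature.MathematicalPhysics.QuantumFieldTheory.Balaban1983to89.B5ResidualGpTorusHolds (TopIdx)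
open Literature.MathematicalPhysics.QuantumFieldTheory.Balaban1983to89.B5Prop12GLattice (famG)
open Literature.MathematicalPhysics.QuantumFieldTheory.Balaban1983to89.B5Prop12GHolds (prop12_famG_printed)
open Literature.MathematicalPhysics.QuantumFieldTheory.Balaban1983to89.LatticeNorms (supNorm norm_le_supNorm supNorm_le supNorm_nonneg)
open Literature.MathematicalPhysics.QuantumFieldTheory.King1986.Torus (blockOf tdistT tdistT_nonneg)
open Literature.MathematicalPhysics.QuantumFieldTheory.Balaban1983to89.B6UnitTorusCarrier (unitTorusGeo)

variable {d : ℕ}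

/-! ## §25 Sources localised in a King block: support in `Δ̃(y′)`, size `≤ loc y′` -/

section Sources

variable {L : ℕ} (M : Fin (d + 1) → ℕ) [∀ μ, NeZero (M μ)] (k n : ℕ) [NeZero n]

/-- a real 1-form vanishing off King's block `B(y′)` has `supp ⊂ Δ̃(y′)` as an embedded (1.110) source. [cite: Balaban1984PropagatorsI, Prop. 1.2 (1.110) p.35 (supp J ⊂ Δ̃(y′))] -/
theorem suppInL_vec_of_isLoc (hn : 1 ≤ n) {μ : Tor (fine n M) × Fin (d + 1) → ℝ} {y' : Tor M}
    (hμ : (BlockNorm.ofBlocks (unitTorusGeo L k M) (fun i : Tor (fine n M) × Fin (d + 1) => blockOf n M i.1)).IsLoc y' μ) :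
    suppInL n M (LocR.vec μ).emb y' := by
  intro b hb
  have hby : blockOf n M b.1 = y' := by
    by_contra h
    exact hb (show ((μ b : ℝ) : ℂ) = 0 by rw [hμ b h, Complex.ofReal_zero])
  rw [← hby]
  exact mem_cubeT_blockOf M n hn b.1

/-- … and its (1.108) size is at most the block sup `loc y′ μ`. [cite: Balaban1984PropagatorsI, (1.108) p.35] -/
theorem supNormL_vec_le_loc {μ : Tor (fine n M) × Fin (d + 1) → ℝ} {y' : Tor M}
    (hμ : (BlockNorm.ofBlocks (unitTorusGeo L k M) (fun i : Tor (fine n M) × Fin (d + 1) => blockOf n M i.1)).IsLoc y' μ) :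
    supNormL n M (LocR.vec μ).emb ≤ (BlockNorm.ofBlocks (unitTorusGeo L k M) (fun i : Tor (fine n M) × Fin (d + 1) => blockOf n M i.1)).loc y' μ := by
  refine supNorm_le ((BlockNorm.ofBlocks (unitTorusGeo L k M) (fun i : Tor (fine n M) × Fin (d + 1) => blockOf n M i.1)).loc_nonneg y' μ)
    fun b _ => ?_
  show ‖((μ b : ℝ) : ℂ)‖ ≤ _
  by_cases hb : blockOf n M b.1 = y'
  · rw [Complex.norm_real, Real.norm_eq_abs]
    exact abs_le_loc_ofBlocks (g := unitTorusGeo L k M) (fun i : Tor (fine n M) × Fin (d + 1) => blockOf n M i.1) μ hb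
  · rw [hμ b hb, Complex.ofReal_zero, norm_zero]
    exact (BlockNorm.ofBlocks (unitTorusGeo L k M) (fun i : Tor (fine n M) × Fin (d + 1) => blockOf n M i.1)).loc_nonneg y' μ

/-- the TENSOR source `J_{ν′} = [ν′ = ν]·μ` of a block-localised `μ`: `supp ⊂ Δ̃(y′)`. [cite: Balaban1984PropagatorsI, Prop. 1.2 (1.110) p.35 (supp J ⊂ Δ̃(y′))] -/
theorem suppInL_ten_of_isLoc (hn : 1 ≤ n) (ν : Fin (d + 1)) {μ : Tor (fine n M) × Fin (d + 1) → ℝ} {y' : Tor M}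
    (hμ : (BlockNorm.ofBlocks (unitTorusGeo L k M) (fun i : Tor (fine n M) × Fin (d + 1) => blockOf n M i.1)).IsLoc y' μ) :
    suppInL n M (LocR.ten fun ν' => if ν' = ν then μ else 0).emb y' := by
  intro ν' b hb
  have hby : blockOf n M b.1 = y' := by
    by_contra h
    refine hb ?_
    show (((if ν' = ν then μ else 0) b : ℝ) : ℂ) = 0
    split_ifs
    · rw [hμ b h, Complex.ofReal_zero]
    · rw [Pi.zero_apply, Complex.ofReal_zero]
  rw [← hby]
  exact mem_cubeT_blockOf M n hn b.1

/-- … and its (1.108) size is at most `loc y′ μ`. [cite: Balaban1984PropagatorsI, (1.108) p.35] -/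
theorem supNormL_ten_le_loc (ν : Fin (d + 1)) {μ : Tor (fine n M) × Fin (d + 1) → ℝ} {y' : Tor M}
    (hμ : (BlockNorm.ofBlocks (unitTorusGeo L k M) (fun i : Tor (fine n M) × Fin (d + 1) => blockOf n M i.1)).IsLoc y' μ) :
    supNormL n M (LocR.ten fun ν' => if ν' = ν then μ else 0).emb
      ≤ (BlockNorm.ofBlocks (unitTorusGeo L k M) (fun i : Tor (fine n M) × Fin (d + 1) => blockOf n M i.1)).loc y' μ := by
  refine supNorm_le ((BlockNorm.ofBlocks (unitTorusGeo L k M) (fun i : Tor (fine n M) × Fin (d + 1) => blockOf n M i.1)).loc_nonneg y' μ)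
    fun p _ => ?_
  show ‖(((if p.1 = ν then μ else 0) p.2 : ℝ) : ℂ)‖ ≤ _
  split_ifs
  · by_cases hb : blockOf n M p.2.1 = y'
    · rw [Complex.norm_real, Real.norm_eq_abs]
      exact abs_le_loc_ofBlocks (g := unitTorusGeo L k M) (fun i : Tor (fine n M) × Fin (d + 1) => blockOf n M i.1) μ hb
    · rw [hμ p.2 hb, Complex.ofReal_zero, norm_zero]
      exact (BlockNorm.ofBlocks (unitTorusGeo L k M) (fun i : Tor (fine n M) × Fin (d + 1) => blockOf n M i.1)).loc_nonneg y' μ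
  · rw [Pi.zero_apply, Complex.ofReal_zero, norm_zero]
    exact (BlockNorm.ofBlocks (unitTorusGeo L k M) (fun i : Tor (fine n M) × Fin (d + 1) => blockOf n M i.1)).loc_nonneg y' μ

/-- every bond of King's block `B(y)` is a bond index of `Δ̃(y)`. [cite: Balaban1984PropagatorsI, Prop. 1.2 (1.110) p.35 (x ∈ Δ̃(y))] -/
theorem mem_cubeB_of_blockOf (hn : 1 ≤ n) {b : Tor (fine n M) × Fin (d + 1)} {y : Tor M} (hb : blockOf n M b.1 = y) : b ∈ cubeB n M y := by
  refine Finset.mem_product.mpr ⟨?_, Finset.mem_univ _⟩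
  rw [← hb]
  exact mem_cubeT_blockOf M n hn b.1

end Sources

/-! ## §26 Dictionaries: `G`, `∇_νG`, `G∇_ν^*`, `ΔG` on embedded real sources are embeddings of the real symbol operators -/

section Dicts

variable (M : Fin (d + 1) → ℕ) [∀ μ, NeZero (M μ)] (n : ℕ) [NeZero n] (a : ℝ)

/-- `G` on an embedded real 1-form (function form of `DeltaA_inv_mulVec_ofReal`). [cite: Balaban1984PropagatorsI, (1.71) p.30] -/
theorem inv_mulVec_ofReal_eq (μ : Tor (fine n M) × Fin (d + 1) → ℝ) :
    ((DeltaA n M a)⁻¹ *ᵥ fun i => ((μ i : ℝ) : ℂ)) = fun i => ((gOp M n a μ i : ℝ) : ℂ) :=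
  funext fun i => DeltaA_inv_mulVec_ofReal M n a μ i

omit [∀ μ, NeZero (M μ)] [NeZero n] in
/-- the symbol identity `(c(s_ν⁻¹ − 1))·(c(s_ν − 1)) = −c²s_ν⁻¹(s_ν − 1)²` (`∇_ν^*∇_ν` is the directional Laplacian symbol of part 35). [cite: Balaban1984PropagatorsI, (1.21) p.21] -/
theorem sTinv_sub_one_mul_sD (ν : Fin (d + 1)) (c : ℝ) : (c • (sTinv M n ν - 1)) * sD M n ν c = sLapDir M n ν c := by
  have h := sT_mul_sTinv M n ν
  simp only [sLapDir, sD, Algebra.smul_def]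
  linear_combination (algebraMap ℝ (AddMonoidAlgebra ℝ (Tor (fine n M))) c ^ 2 * (sT M n ν - 1)) * h

/-- **`Δ` (b05's `Lap = Σ_ν ∇_ν^*∇_ν`) on an embedded real 1-form is the embedding of `ρ(sLap n)`** (part 35's Laplacian symbol at lattice factor `n = η⁻¹`).
[cite: Balaban1984PropagatorsI, (1.21) p.21, (1.31) p.23] -/
theorem Lap_mulVec_ofReal (u : Tor (fine n M) × Fin (d + 1) → ℝ) :
    (Lap n M *ᵥ fun i => ((u i : ℝ) : ℂ)) = fun i => ((symbOp M n (sLap M n n) u i : ℝ) : ℂ) := by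
  rw [Lap, Matrix.sum_mulVec]
  funext i
  rw [Finset.sum_apply, sLap, map_sum, LinearMap.sum_apply, Finset.sum_apply, Complex.ofReal_sum]
  refine Finset.sum_congr rfl fun ν _ => ?_
  rw [← Matrix.mulVec_mulVec, show (fdiff (fine n M) (n : ℂ) ν *ᵥ fun i => ((u i : ℝ) : ℂ)) = fun i => ((symbOp M n (sD M n ν n) u i : ℝ) : ℂ) from
    funext fun i => fdiff_mulVec_ofReal M n ν u i, ← Matrix.star_eq_conjTranspose, star_fdiff_mulVec_ofReal, ← sTinv_sub_one_mul_sD, map_mul,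
    Module.End.mul_apply]

end Dicts

/-! ## §27 THE (1.110) ENTRIES AS BLOCK MAJORANTS, GENERIC IN `n`: for EVERY setting `latticeSettingP12R n M a K` satisfying `B5.Ineq110_114` -/

section Entries

variable {L : ℕ} (M : Fin (d + 1) → ℕ) [∀ μ, NeZero (M μ)] (k n : ℕ) [NeZero n] (a : ℝ)

/-- **ENTRY 0 «GJ», generic**: `HasMaj … (gOp M n a) (C·e^{−δ₀ tdistT})` from the (1.110) clause of `B5.Ineq110_114 (latticeSettingP12R n M a K) C … δ₀` (`C ≥ 0`, `n ≥ 1`), on the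
carrier `unitTorusGeo L k M` with the fine 1-forms blocked by King's unit blocks of `Tor (fine n M)` (`k` and `n` independent). [cite: Balaban1984PropagatorsI, Prop. 1.2 (1.110) p.35] -/
theorem hasMaj_gOp_of_ineq (hn : 1 ≤ n) {K : ℕ} {C δ₀ : ℝ} {Cα Cε : ℝ → ℝ} {Cαε : ℝ → ℝ → ℝ}
    (H : B5.Ineq110_114 (latticeSettingP12R n M a K) C Cα Cε Cαε δ₀) (hC : 0 ≤ C) :
    HasMaj (BlockNorm.ofBlocks (unitTorusGeo L k M) (fun i : Tor (fine n M) × Fin (d + 1) => blockOf n M i.1))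
      (BlockNorm.ofBlocks (unitTorusGeo L k M) (fun i : Tor (fine n M) × Fin (d + 1) => blockOf n M i.1))
      (gOp M n a) (fun y y' => C * Real.exp (-(δ₀ * tdistT M y y'))) := by
  intro y' μ hμ y
  set b₁ := BlockNorm.ofBlocks (unitTorusGeo L k M) (fun i : Tor (fine n M) × Fin (d + 1) => blockOf n M i.1) with hb₁
  have hineq : eL n M a 0 (LocR.vec μ).emb y ≤ C * Real.exp (-(δ₀ * distSite M y y')) * supNormL n M (LocR.vec μ).emb :=
    H.1 0 (LocR.vec μ) y y' (suppInL_vec_of_isLoc M k n hn hμ)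
  have hsrc := supNormL_vec_le_loc M k n hμ
  refine loc_ofBlocks_le (g := unitTorusGeo L k M) (fun i : Tor (fine n M) × Fin (d + 1) => blockOf n M i.1) _
    (mul_nonneg (mul_nonneg hC (Real.exp_nonneg _)) (b₁.loc_nonneg y' μ)) fun b hb => ?_
  have hobs : |gOp M n a μ b| ≤ eL n M a 0 (LocR.vec μ).emb y := by
    have h := norm_le_supNorm ((DeltaA n M a)⁻¹ *ᵥ fun i => ((μ i : ℝ) : ℂ)) (mem_cubeB_of_blockOf M n hn hb)
    rw [DeltaA_inv_mulVec_ofReal M n a μ b, Complex.norm_real, Real.norm_eq_abs] at h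
    exact h
  calc |gOp M n a μ b| ≤ eL n M a 0 (LocR.vec μ).emb y := hobs
    _ ≤ C * Real.exp (-(δ₀ * distSite M y y')) * supNormL n M (LocR.vec μ).emb := hineq
    _ ≤ C * Real.exp (-(δ₀ * tdistT M y y')) * b₁.loc y' μ := by
        rw [distSite_eq_tdistT]
        exact mul_le_mul_of_nonneg_left hsrc (mul_nonneg hC (Real.exp_nonneg _))

/-- **ENTRY 1 «∇GJ», generic**: `HasMaj … (ρ(n(s_ν − 1)) ∘ gOp M n a) (C·e^{−δ₀ tdistT})`. [cite: Balaban1984PropagatorsI, Prop. 1.2 (1.110) p.35] -/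
theorem hasMaj_grad_of_ineq (hn : 1 ≤ n) {K : ℕ} {C δ₀ : ℝ} {Cα Cε : ℝ → ℝ} {Cαε : ℝ → ℝ → ℝ}
    (H : B5.Ineq110_114 (latticeSettingP12R n M a K) C Cα Cε Cαε δ₀) (hC : 0 ≤ C) (ν : Fin (d + 1)) :
    HasMaj (BlockNorm.ofBlocks (unitTorusGeo L k M) (fun i : Tor (fine n M) × Fin (d + 1) => blockOf n M i.1))
      (BlockNorm.ofBlocks (unitTorusGeo L k M) (fun i : Tor (fine n M) × Fin (d + 1) => blockOf n M i.1))
      (symbOp M n (sD M n ν n) ∘ₗ gOp M n a) (fun y y' => C * Real.exp (-(δ₀ * tdistT M y y'))) := by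
  intro y' μ hμ y
  set b₁ := BlockNorm.ofBlocks (unitTorusGeo L k M) (fun i : Tor (fine n M) × Fin (d + 1) => blockOf n M i.1) with hb₁
  have hineq : eL n M a 1 (LocR.vec μ).emb y ≤ C * Real.exp (-(δ₀ * distSite M y y')) * supNormL n M (LocR.vec μ).emb :=
    H.1 1 (LocR.vec μ) y y' (suppInL_vec_of_isLoc M k n hn hμ)
  have hsrc := supNormL_vec_le_loc M k n hμ
  refine loc_ofBlocks_le (g := unitTorusGeo L k M) (fun i : Tor (fine n M) × Fin (d + 1) => blockOf n M i.1) _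
    (mul_nonneg (mul_nonneg hC (Real.exp_nonneg _)) (b₁.loc_nonneg y' μ)) fun b hb => ?_
  have hbc : (ν, b) ∈ Finset.univ ×ˢ cubeB n M y := Finset.mem_product.mpr ⟨Finset.mem_univ _, mem_cubeB_of_blockOf M n hn hb⟩
  have hobs : |(symbOp M n (sD M n ν n) ∘ₗ gOp M n a) μ b| ≤ eL n M a 1 (LocR.vec μ).emb y := by
    have h := norm_le_supNorm (fun p : Fin (d + 1) × (Tor (fine n M) × Fin (d + 1)) => grad n M ((DeltaA n M a)⁻¹ *ᵥ fun i => ((μ i : ℝ) : ℂ)) p.1 p.2) hbc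
    have e : grad n M ((DeltaA n M a)⁻¹ *ᵥ fun i => ((μ i : ℝ) : ℂ)) ν b = (((symbOp M n (sD M n ν n) ∘ₗ gOp M n a) μ b : ℝ) : ℂ) := by
      rw [grad, inv_mulVec_ofReal_eq, fdiff_mulVec_ofReal, LinearMap.comp_apply]
    simp only at h
    rw [e, Complex.norm_real, Real.norm_eq_abs] at h
    exact h
  calc |(symbOp M n (sD M n ν n) ∘ₗ gOp M n a) μ b| ≤ eL n M a 1 (LocR.vec μ).emb y := hobs
    _ ≤ C * Real.exp (-(δ₀ * distSite M y y')) * supNormL n M (LocR.vec μ).emb := hineq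
    _ ≤ C * Real.exp (-(δ₀ * tdistT M y y')) * b₁.loc y' μ := by
        rw [distSite_eq_tdistT]
        exact mul_le_mul_of_nonneg_left hsrc (mul_nonneg hC (Real.exp_nonneg _))

/-- **ENTRY 2 «G∇*J», generic**: `HasMaj … (gOp M n a ∘ ρ(n(s_ν⁻¹ − 1))) (C·e^{−δ₀ tdistT})` (through the tensor source `J_{ν′} = [ν′ = ν]μ`).
[cite: Balaban1984PropagatorsI, Prop. 1.2 (1.110) p.35] -/
theorem hasMaj_gDivAdj_of_ineq (hn : 1 ≤ n) {K : ℕ} {C δ₀ : ℝ} {Cα Cε : ℝ → ℝ} {Cαε : ℝ → ℝ → ℝ}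
    (H : B5.Ineq110_114 (latticeSettingP12R n M a K) C Cα Cε Cαε δ₀) (hC : 0 ≤ C) (ν : Fin (d + 1)) :
    HasMaj (BlockNorm.ofBlocks (unitTorusGeo L k M) (fun i : Tor (fine n M) × Fin (d + 1) => blockOf n M i.1))
      (BlockNorm.ofBlocks (unitTorusGeo L k M) (fun i : Tor (fine n M) × Fin (d + 1) => blockOf n M i.1))
      (gOp M n a ∘ₗ symbOp M n ((n : ℝ) • (sTinv M n ν - 1))) (fun y y' => C * Real.exp (-(δ₀ * tdistT M y y'))) := by
  intro y' μ hμ y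
  set b₁ := BlockNorm.ofBlocks (unitTorusGeo L k M) (fun i : Tor (fine n M) × Fin (d + 1) => blockOf n M i.1) with hb₁
  set Jt : LocR n M := LocR.ten fun ν' => if ν' = ν then μ else 0 with hJt
  have hineq : eL n M a 2 Jt.emb y ≤ C * Real.exp (-(δ₀ * distSite M y y')) * supNormL n M Jt.emb :=
    H.1 2 Jt y y' (suppInL_ten_of_isLoc M k n hn ν hμ)
  have hsrc := supNormL_ten_le_loc M k n ν hμ
  refine loc_ofBlocks_le (g := unitTorusGeo L k M) (fun i : Tor (fine n M) × Fin (d + 1) => blockOf n M i.1) _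
    (mul_nonneg (mul_nonneg hC (Real.exp_nonneg _)) (b₁.loc_nonneg y' μ)) fun b hb => ?_
  have hdiv : divT n M (fun s b' => (((if s = ν then μ else 0) b' : ℝ) : ℂ)) = fun i => ((symbOp M n ((n : ℝ) • (sTinv M n ν - 1)) μ i : ℝ) : ℂ) := by
    rw [divT, Finset.sum_eq_single ν (fun s _ hs => by
        rw [show (fun b' => (((if s = ν then μ else 0) b' : ℝ) : ℂ)) = 0 from funext fun b' => by simp [hs], Matrix.mulVec_zero])
      (fun h => absurd (Finset.mem_univ ν) h)]
    funext i
    rw [show (fun b' => (((if ν = ν then μ else 0) b' : ℝ) : ℂ)) = fun b' => ((μ b' : ℝ) : ℂ) from funext fun b' => by simp, star_fdiff_mulVec_ofReal]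
  have hobs : |(gOp M n a ∘ₗ symbOp M n ((n : ℝ) • (sTinv M n ν - 1))) μ b| ≤ eL n M a 2 Jt.emb y := by
    have h := norm_le_supNorm ((DeltaA n M a)⁻¹ *ᵥ divT n M (fun s b' => (((if s = ν then μ else 0) b' : ℝ) : ℂ))) (mem_cubeB_of_blockOf M n hn hb)
    have e : ((DeltaA n M a)⁻¹ *ᵥ divT n M (fun s b' => (((if s = ν then μ else 0) b' : ℝ) : ℂ))) b =
        (((gOp M n a ∘ₗ symbOp M n ((n : ℝ) • (sTinv M n ν - 1))) μ b : ℝ) : ℂ) := by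
      rw [hdiv, inv_mulVec_ofReal_eq, LinearMap.comp_apply]
    rw [e, Complex.norm_real, Real.norm_eq_abs] at h
    exact h
  calc |(gOp M n a ∘ₗ symbOp M n ((n : ℝ) • (sTinv M n ν - 1))) μ b| ≤ eL n M a 2 Jt.emb y := hobs
    _ ≤ C * Real.exp (-(δ₀ * distSite M y y')) * supNormL n M Jt.emb := hineq
    _ ≤ C * Real.exp (-(δ₀ * tdistT M y y')) * b₁.loc y' μ := by
        rw [distSite_eq_tdistT]
        exact mul_le_mul_of_nonneg_left hsrc (mul_nonneg hC (Real.exp_nonneg _))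

/-- **ENTRY 3 «ΔGJ», generic**: `HasMaj … (ρ(sLap n) ∘ gOp M n a) (C·e^{−δ₀ tdistT})` (`Δ = Σ_ν∇_ν^*∇_ν`, part 35's `sLap` at `c = n`).
[cite: Balaban1984PropagatorsI, Prop. 1.2 (1.110) p.35] -/
theorem hasMaj_lap_of_ineq (hn : 1 ≤ n) {K : ℕ} {C δ₀ : ℝ} {Cα Cε : ℝ → ℝ} {Cαε : ℝ → ℝ → ℝ}
    (H : B5.Ineq110_114 (latticeSettingP12R n M a K) C Cα Cε Cαε δ₀) (hC : 0 ≤ C) :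
    HasMaj (BlockNorm.ofBlocks (unitTorusGeo L k M) (fun i : Tor (fine n M) × Fin (d + 1) => blockOf n M i.1))
      (BlockNorm.ofBlocks (unitTorusGeo L k M) (fun i : Tor (fine n M) × Fin (d + 1) => blockOf n M i.1))
      (symbOp M n (sLap M n n) ∘ₗ gOp M n a) (fun y y' => C * Real.exp (-(δ₀ * tdistT M y y'))) := by
  intro y' μ hμ y
  set b₁ := BlockNorm.ofBlocks (unitTorusGeo L k M) (fun i : Tor (fine n M) × Fin (d + 1) => blockOf n M i.1) with hb₁
  have hineq : eL n M a 3 (LocR.vec μ).emb y ≤ C * Real.exp (-(δ₀ * distSite M y y')) * supNormL n M (LocR.vec μ).emb :=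
    H.1 3 (LocR.vec μ) y y' (suppInL_vec_of_isLoc M k n hn hμ)
  have hsrc := supNormL_vec_le_loc M k n hμ
  refine loc_ofBlocks_le (g := unitTorusGeo L k M) (fun i : Tor (fine n M) × Fin (d + 1) => blockOf n M i.1) _
    (mul_nonneg (mul_nonneg hC (Real.exp_nonneg _)) (b₁.loc_nonneg y' μ)) fun b hb => ?_
  have hobs : |(symbOp M n (sLap M n n) ∘ₗ gOp M n a) μ b| ≤ eL n M a 3 (LocR.vec μ).emb y := by
    have h := norm_le_supNorm (Lap n M *ᵥ ((DeltaA n M a)⁻¹ *ᵥ fun i => ((μ i : ℝ) : ℂ))) (mem_cubeB_of_blockOf M n hn hb)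
    have e : (Lap n M *ᵥ ((DeltaA n M a)⁻¹ *ᵥ fun i => ((μ i : ℝ) : ℂ))) b = (((symbOp M n (sLap M n n) ∘ₗ gOp M n a) μ b : ℝ) : ℂ) := by
      rw [inv_mulVec_ofReal_eq, Lap_mulVec_ofReal, LinearMap.comp_apply]
    rw [show eL n M a 3 (LocR.vec μ).emb y = supNorm (cubeB n M y) (Lap n M *ᵥ ((DeltaA n M a)⁻¹ *ᵥ fun i => ((μ i : ℝ) : ℂ))) from rfl]
    rw [e, Complex.norm_real, Real.norm_eq_abs] at h
    exact h
  calc |(symbOp M n (sLap M n n) ∘ₗ gOp M n a) μ b| ≤ eL n M a 3 (LocR.vec μ).emb y := hobs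
    _ ≤ C * Real.exp (-(δ₀ * distSite M y y')) * supNormL n M (LocR.vec μ).emb := hineq
    _ ≤ C * Real.exp (-(δ₀ * tdistT M y y')) * b₁.loc y' μ := by
        rw [distSite_eq_tdistT]
        exact mul_le_mul_of_nonneg_left hsrc (mul_nonneg hC (Real.exp_nonneg _))

end Entries

/-! ## §28 The η-PAIR OF RECORD: both members `n = L^k` and `n′ = L^m·L^k` (same unit torus `M_μ = 2L^{m_T}`) satisfy `B5.Ineq110_114` with ONE set of constants -/

section Pair

/-- transport of `B5.Ineq110_114` for the real lattice setting along an equality of the fineness parameter (`NeZero` is a `Prop`). [folklore] -/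
theorem ineq110_114_congr {n n' : ℕ} [NeZero n] [NeZero n'] (h : n = n') (M : Fin (d + 1) → ℕ) [∀ μ, NeZero (M μ)] (a : ℝ) (K : ℕ)
    (C : ℝ) (Cα Cε : ℝ → ℝ) (Cαε : ℝ → ℝ → ℝ) (δ₀ : ℝ) :
    B5.Ineq110_114 (latticeSettingP12R n M a K) C Cα Cε Cαε δ₀ ↔ B5.Ineq110_114 (latticeSettingP12R n' M a K) C Cα Cε Cαε δ₀ := by
  subst h
  exact Iff.rfl

/-- ★ **THE η-PAIR OF RECORD SATISFIES (1.110)–(1.114) WITH ONE SET OF CONSTANTS**: for odd `L > 1`, `a > 0` there are `δ₀, C > 0`, `C_α, C_ε, C_{αε}` such that for every torus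
exponent `m_T`, every coarse scale `k ≥ 1` and every refinement exponent `m`, BOTH the coarse member (`n = L^k`) and the fine member (`n′ = L^m·L^k`, typed on
`Tor (fine (L^m * L^k) M)` as parts 34∕35∕37 have it) of Bałaban's torus family `famG (d+1) L a` satisfy `B5.Ineq110_114` — `prop12_famG_printed` at the indices
`K = k` and `K = m + k` (`L^{m+k} = L^m·L^k`). [cite: Balaban1984PropagatorsI, Prop. 1.2 (1.110)–(1.114) pp.35–36] -/
theorem ineq110_114_pair {L : ℕ} [NeZero L] (hL : Odd L ∧ 1 < L) {a : ℝ} (ha : 0 < a) :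
    ∃ δ₀ C : ℝ, ∃ Cα Cε : ℝ → ℝ, ∃ Cαε : ℝ → ℝ → ℝ, 0 < δ₀ ∧ 0 < C ∧ ∀ (mT k m : ℕ) (hk : 1 ≤ k),
      B5.Ineq110_114 (latticeSettingP12R (L ^ k) (MP (paramsOf d L mT k hL)) a k) C Cα Cε Cαε δ₀ ∧
      B5.Ineq110_114 (latticeSettingP12R (L ^ m * L ^ k) (MP (paramsOf d L mT k hL)) a (m + k)) C Cα Cε Cαε δ₀ := by
  obtain ⟨δ₀, C, Cα, Cε, Cαε, hδ₀, hC, H⟩ := prop12_famG_printed (d := d + 1) (L := L) (Nat.succ_pos d) hL ha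
  refine ⟨δ₀, C, Cα, Cε, Cαε, hδ₀, hC, fun mT k m hk => ⟨H (topIdxOf d L mT k hL hk), ?_⟩⟩
  have h2 := H (topIdxOf d L mT (m + k) hL (hk.trans (Nat.le_add_left k m)))
  exact (ineq110_114_congr (show L ^ (m + k) = L ^ m * L ^ k by rw [pow_add, mul_comm]) (MP (paramsOf d L mT k hL)) a (m + k)
    C Cα Cε Cαε δ₀).mp h2

end Pair

end Summit.QuantumFields.YangMills.BalabanUVNodes.N15.TwoGrid
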